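import Literature.Computability.AlgebraicComplexity.SyntacticMultilinearAppend
import Literature.Computability.AlgebraicComplexity.ArithCircuitProofs
import Literature.Computability.AlgebraicComplexity.SetMultilinear
import HarnessLib

/-!
# Set-multilinear projections of a circuit, computed by a syntactically multilinear gate list

Theorem-only file (no definitions). Limaye–Srinivasan–Tavenas (J. ACM 72 (2025) Art. 26 = FOCS
2021), proof of Lemma 12: every gate `α` of a circuit is replaced by gates `α_S`, one per set `S`
of variable blocks, computing "the projection of the polynomial computed by `α` to the
set-multilinear part associated to `S`" (the tree's `smlProj blk S`, `SetMultilinear.lean`); sums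
go componentwise and a product `α = β · γ` becomes `α_S = ∑_{S₁ ⊆ S} β_{S₁} · γ_{S ∖ S₁}`
(`smlProj_mul`). Raz–Yehudayoff (Comput. Complexity 17 (2008) §2): a circuit is syntactically
multilinear when the two subcircuits of every product gate mention disjoint sets of variables.

**What is proved** (`exists_smlProj_gateList`). Work in the tree's straight-line model
(`ArithCircuit`, gate lists grown at the end, `SyntacticMultilinearAppend.lean`). Fix a block map
`blk : σ → ι` (`ι` finite), a substitution `φ : σ → MvPolynomial τ R` of the leaves and pairwise
disjoint variable budgets `V : ι → Finset τ`. Suppose a fan-in-two, syntactically multilinear gate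
list `gs₀` over `τ` makes every `φ v` available through an operand whose SYNTACTIC variable set lies
in `V (blk v)`. Then for every fan-in-two circuit `Γ` over `σ` the list can be extended by at most
`2 · 4 ^ |ι| · |Γ|` gates, staying fan-in-two and syntactically multilinear, so that for every block
set `S` the polynomial `aeval φ (smlProj blk S Γ.eval)` is available through an operand with
syntactic variable set inside `⋃_{i ∈ S} V i`. The product gates appended are the `β_{S₁} · γ_{S∖S₁}`,
whose operands live in the disjoint budgets `⋃_{S₁} V` and `⋃_{S∖S₁} V` — this is where syntactic
multilinearity comes from. Junk gate references of `Γ` (value `0`) are harmless (their projections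
are the constant `0`), so no well-formedness hypothesis is needed.

Consumer: the tripartition bridge `PerLeTripartition` of route `ValiantsHypothesis/RyserTripartition`
(`ι = Fin 3` row blocks, `φ (b, S)` = the `k × k` sub-permanent table, `Γ` a circuit for Pratt's
`T_k`). HONEST FRAMING: circuit bookkeeping of a published construction; nothing here bears on
`VP ≠ VNP`.

## References

* [LimayeSrinivasanTavenas2025] N. Limaye, S. Srinivasan, S. Tavenas, J. ACM 72 (2025), Art. 26,
  §3, proof of Lemma 12 (the gates `α_S`).
* [RazYehudayoff2008] R. Raz, A. Yehudayoff, Comput. Complexity 17 (2008), §2.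
-/

noncomputable section

namespace Literature.Computability.AlgebraicComplexity

open MvPolynomial ArithCircuit

namespace SmlHomogenise

universe u v w x

variable {R : Type u} [CommSemiring R] {σ : Type v} {τ : Type w} {ι : Type x}
variable [DecidableEq τ] [DecidableEq ι]

/-! ### Availability with a syntactic variable budget: monotonicity and the free operands -/

/-- Availability (value AND syntactic variable budget) of a polynomial through an operand persists
when the gate list is extended. [cite: RazYehudayoff2008, §2] -/
theorem avail_mono {gs gs' : List (Gate R τ)} (h : gs <+: gs') {p : MvPolynomial τ R}
    {W : Finset τ}
    (hp : ∃ u : Operand R τ, u.RefsBelow gs.length ∧ u.eval (gateValues gs) = p ∧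
      operandVarSet (gateVarSets gs) u ⊆ W) :
    ∃ u : Operand R τ, u.RefsBelow gs'.length ∧ u.eval (gateValues gs') = p ∧
      operandVarSet (gateVarSets gs') u ⊆ W := by
  obtain ⟨u, hu, rfl, hW⟩ := hp
  exact ⟨u, SmAppend.refsBelow_of_prefix h hu, Hrubes2020.operand_eval_of_prefix h hu,
    (SmAppend.operandVarSet_of_prefix h hu).symm ▸ hW⟩

/-- Constants are available for free, with empty variable budget. [cite: Burgisser2000, Def. 2.1] -/
theorem avail_C (gs : List (Gate R τ)) (c : R) (W : Finset τ) :
    ∃ u : Operand R τ, u.RefsBelow gs.length ∧ u.eval (gateValues gs) = C c ∧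
      operandVarSet (gateVarSets gs) u ⊆ W :=
  ⟨.const c, trivial, rfl, by simp⟩

/-- Availability is invariant under rewriting the target polynomial (bookkeeping in the
straight-line model). [cite: Burgisser2000, Def. 2.1] -/
theorem avail_congr {gs : List (Gate R τ)} {p q : MvPolynomial τ R} (hpq : p = q) {W : Finset τ}
    (hp : ∃ u : Operand R τ, u.RefsBelow gs.length ∧ u.eval (gateValues gs) = p ∧
      operandVarSet (gateVarSets gs) u ⊆ W) :
    ∃ u : Operand R τ, u.RefsBelow gs.length ∧ u.eval (gateValues gs) = q ∧
      operandVarSet (gateVarSets gs) u ⊆ W := hpq ▸ hp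

/-- Enlarging the variable budget of an available operand (bookkeeping in the straight-line
model). [cite: Burgisser2000, Def. 2.1] -/
theorem avail_budget_mono {gs : List (Gate R τ)} {p : MvPolynomial τ R} {W W' : Finset τ}
    (hWW' : W ⊆ W')
    (hp : ∃ u : Operand R τ, u.RefsBelow gs.length ∧ u.eval (gateValues gs) = p ∧
      operandVarSet (gateVarSets gs) u ⊆ W) :
    ∃ u : Operand R τ, u.RefsBelow gs.length ∧ u.eval (gateValues gs) = p ∧
      operandVarSet (gateVarSets gs) u ⊆ W' := by
  obtain ⟨u, hu, hv, hW⟩ := hp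
  exact ⟨u, hu, hv, hW.trans hWW'⟩

/-! ### One linear combination, one product-sum -/

/-- **Linear step.** From availability of `p` and `q` (budgets inside `W`), one appended sum gate
makes `a • p + b • q` available with budget `W`. [cite: RazYehudayoff2008, §2] -/
theorem extend_lin {gs : List (Gate R τ)} (h2 : ∀ g ∈ gs, g.fanIn ≤ 2)
    (hsm : IsSyntacticallyMultilinear (⟨gs, Operand.gate 0⟩ : ArithCircuit R τ))
    (a b : R) {p q : MvPolynomial τ R} {W : Finset τ}
    (hp : ∃ u : Operand R τ, u.RefsBelow gs.length ∧ u.eval (gateValues gs) = p ∧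
      operandVarSet (gateVarSets gs) u ⊆ W)
    (hq : ∃ u : Operand R τ, u.RefsBelow gs.length ∧ u.eval (gateValues gs) = q ∧
      operandVarSet (gateVarSets gs) u ⊆ W) :
    ∃ gs' : List (Gate R τ), gs <+: gs' ∧ (∀ g ∈ gs', g.fanIn ≤ 2) ∧
      IsSyntacticallyMultilinear (⟨gs', Operand.gate 0⟩ : ArithCircuit R τ) ∧
      gs'.length ≤ gs.length + 1 ∧
      ∃ u : Operand R τ, u.RefsBelow gs'.length ∧ u.eval (gateValues gs') = a • p + b • q ∧
        operandVarSet (gateVarSets gs') u ⊆ W := by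
  obtain ⟨u, -, rfl, huW⟩ := hp
  obtain ⟨w, -, rfl, hwW⟩ := hq
  obtain ⟨h2', hsm', href, hval, hvs⟩ := SmAppend.step_sum₂ h2 hsm a b huW hwW
  exact ⟨_, List.prefix_append _ _, h2', hsm', by simp, Operand.gate gs.length, href, hval,
    hvs.trans (Finset.union_subset le_rfl le_rfl)⟩

/-- **Product-sum step.** Given a finite set `T` of indices and, for each `t ∈ T`, availability of
`p t` with budget `W₁ t` and of `q t` with budget `W₂ t`, where `W₁ t` and `W₂ t` are DISJOINT and
both inside `W`: at most `2 · |T|` appended gates (one product and one sum per index) make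
`∑_{t ∈ T} p t · q t` available with budget `W`, keeping fan-in two and syntactic multilinearity.
[cite: RazYehudayoff2008, §2] -/
theorem extend_prodSum {κ : Type*} (T : Finset κ) {gs : List (Gate R τ)}
    (h2 : ∀ g ∈ gs, g.fanIn ≤ 2)
    (hsm : IsSyntacticallyMultilinear (⟨gs, Operand.gate 0⟩ : ArithCircuit R τ))
    (p q : κ → MvPolynomial τ R) (W₁ W₂ : κ → Finset τ) (W : Finset τ)
    (hdis : ∀ t ∈ T, Disjoint (W₁ t) (W₂ t)) (hW₁ : ∀ t ∈ T, W₁ t ⊆ W) (hW₂ : ∀ t ∈ T, W₂ t ⊆ W)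
    (hp : ∀ t ∈ T, ∃ u : Operand R τ, u.RefsBelow gs.length ∧ u.eval (gateValues gs) = p t ∧
      operandVarSet (gateVarSets gs) u ⊆ W₁ t)
    (hq : ∀ t ∈ T, ∃ u : Operand R τ, u.RefsBelow gs.length ∧ u.eval (gateValues gs) = q t ∧
      operandVarSet (gateVarSets gs) u ⊆ W₂ t) :
    ∃ gs' : List (Gate R τ), gs <+: gs' ∧ (∀ g ∈ gs', g.fanIn ≤ 2) ∧
      IsSyntacticallyMultilinear (⟨gs', Operand.gate 0⟩ : ArithCircuit R τ) ∧
      gs'.length ≤ gs.length + 2 * T.card ∧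
      ∃ u : Operand R τ, u.RefsBelow gs'.length ∧
        u.eval (gateValues gs') = ∑ t ∈ T, p t * q t ∧
        operandVarSet (gateVarSets gs') u ⊆ W := by
  classical
  induction T using Finset.induction_on generalizing gs with
  | empty =>
    exact ⟨gs, List.prefix_rfl, h2, hsm, by simp, .const 0, trivial, by simp [Operand.eval], by simp⟩
  | @insert t T ht ih =>
    -- first the rest of the set
    obtain ⟨gs₁, hpre₁, h2₁, hsm₁, hlen₁, acc, hacc, hacc_val, hacc_vs⟩ :=
      ih h2 hsm (fun s hs => hdis s (Finset.mem_insert_of_mem hs))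
        (fun s hs => hW₁ s (Finset.mem_insert_of_mem hs))
        (fun s hs => hW₂ s (Finset.mem_insert_of_mem hs))
        (fun s hs => hp s (Finset.mem_insert_of_mem hs))
        (fun s hs => hq s (Finset.mem_insert_of_mem hs))
    -- the product gate for `t`
    obtain ⟨u, hu, hu_val, hu_vs⟩ :=
      avail_mono hpre₁ (hp t (Finset.mem_insert_self t T))
    obtain ⟨w, hw, hw_val, hw_vs⟩ :=
      avail_mono hpre₁ (hq t (Finset.mem_insert_self t T))
    obtain ⟨h2₂, hsm₂, href₂, hval₂, hvs₂⟩ :=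
      SmAppend.step_prod₂ h2₁ hsm₁ hu_vs hw_vs (hdis t (Finset.mem_insert_self t T))
    set gs₂ := gs₁ ++ [Gate.prod [u, w]] with hgs₂
    have hpre₁₂ : gs₁ <+: gs₂ := List.prefix_append _ _
    -- the sum gate `acc + (u w)`
    have hacc₂ : (acc : Operand R τ).RefsBelow gs₂.length := SmAppend.refsBelow_of_prefix hpre₁₂ hacc
    have hacc_vs₂ : operandVarSet (gateVarSets gs₂) acc ⊆ W := by
      rw [SmAppend.operandVarSet_of_prefix hpre₁₂ hacc]; exact hacc_vs
    have hnew_vs₂ : operandVarSet (gateVarSets gs₂) (Operand.gate gs₁.length : Operand R τ) ⊆ W :=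
      hvs₂.trans (Finset.union_subset (hW₁ t (Finset.mem_insert_self t T))
        (hW₂ t (Finset.mem_insert_self t T)))
    obtain ⟨h2₃, hsm₃, href₃, hval₃, hvs₃⟩ :=
      SmAppend.step_sum₂ h2₂ hsm₂ (1 : R) (1 : R) hacc_vs₂ hnew_vs₂
    refine ⟨gs₂ ++ [Gate.sum [((1 : R), acc), ((1 : R), Operand.gate gs₁.length)]],
      hpre₁.trans (hpre₁₂.trans (List.prefix_append _ _)), h2₃, hsm₃, ?_,
      Operand.gate gs₂.length, href₃, ?_, hvs₃.trans (Finset.union_subset le_rfl le_rfl)⟩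
    · simp only [hgs₂, List.length_append, List.length_singleton, Finset.card_insert_of_notMem ht]
      omega
    · rw [hval₃, Finset.sum_insert ht, one_smul, one_smul,
        Hrubes2020.operand_eval_of_prefix hpre₁₂ hacc, hacc_val, hval₂, hu_val, hw_val, add_comm]

/-! ### Iterating independent targets -/

/-- Achieving finitely many INDEPENDENT availability targets one after the other: if each target
can be reached from any good extension at cost `≤ cost`, all of them hold together after
`cost · |T|` gates (earlier targets persist by `avail_mono`; the straight-line program is only
ever extended at the end). [cite: Burgisser2000, Def. 2.1] -/
theorem iterate_targets {κ : Type*} (T : Finset κ) (goal : κ → MvPolynomial τ R)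
    (Wt : κ → Finset τ) (cost : ℕ) {gs : List (Gate R τ)} (h2 : ∀ g ∈ gs, g.fanIn ≤ 2)
    (hsm : IsSyntacticallyMultilinear (⟨gs, Operand.gate 0⟩ : ArithCircuit R τ))
    (hstep : ∀ t ∈ T, ∀ gs' : List (Gate R τ), gs <+: gs' → (∀ g ∈ gs', g.fanIn ≤ 2) →
      IsSyntacticallyMultilinear (⟨gs', Operand.gate 0⟩ : ArithCircuit R τ) →
      ∃ gs'' : List (Gate R τ), gs' <+: gs'' ∧ (∀ g ∈ gs'', g.fanIn ≤ 2) ∧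
        IsSyntacticallyMultilinear (⟨gs'', Operand.gate 0⟩ : ArithCircuit R τ) ∧
        gs''.length ≤ gs'.length + cost ∧
        ∃ u : Operand R τ, u.RefsBelow gs''.length ∧ u.eval (gateValues gs'') = goal t ∧
          operandVarSet (gateVarSets gs'') u ⊆ Wt t) :
    ∃ gs' : List (Gate R τ), gs <+: gs' ∧ (∀ g ∈ gs', g.fanIn ≤ 2) ∧
      IsSyntacticallyMultilinear (⟨gs', Operand.gate 0⟩ : ArithCircuit R τ) ∧
      gs'.length ≤ gs.length + cost * T.card ∧
      ∀ t ∈ T, ∃ u : Operand R τ, u.RefsBelow gs'.length ∧ u.eval (gateValues gs') = goal t ∧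
        operandVarSet (gateVarSets gs') u ⊆ Wt t := by
  classical
  induction T using Finset.induction_on with
  | empty => exact ⟨gs, List.prefix_rfl, h2, hsm, by simp, fun t ht => absurd ht (by simp)⟩
  | @insert t T ht ih =>
    obtain ⟨gs₁, hpre₁, h2₁, hsm₁, hlen₁, havail₁⟩ :=
      ih fun s hs => hstep s (Finset.mem_insert_of_mem hs)
    obtain ⟨gs₂, hpre₂, h2₂, hsm₂, hlen₂, havail₂⟩ :=
      hstep t (Finset.mem_insert_self t T) gs₁ hpre₁ h2₁ hsm₁
    refine ⟨gs₂, hpre₁.trans hpre₂, h2₂, hsm₂, ?_, fun s hs => ?_⟩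
    · rw [Finset.card_insert_of_notMem ht, Nat.mul_succ]; omega
    · rcases Finset.mem_insert.mp hs with rfl | hs
      · exact havail₂
      · exact avail_mono hpre₂ (havail₁ s hs)

/-! ### The set-multilinear projections of one gate -/

section Gate

variable [Fintype ι] (blk : σ → ι) (φ : σ → MvPolynomial τ R) (V : ι → Finset τ)

omit [Fintype ι] in
/-- **Operands.** If the projections of all earlier gate values are available (budget
`⋃_{i∈S} V i` for block set `S`) and every leaf `φ v` is available with budget `V (blk v)`, then
the projections of the value of any operand of the old circuit are available (junk references
read `0`). [cite: LimayeSrinivasanTavenas2025, Lemma 12] -/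
theorem avail_operand {gs : List (Gate R τ)} (vals : List (MvPolynomial σ R))
    (hvals : ∀ p ∈ vals, ∀ S : Finset ι, ∃ u : Operand R τ, u.RefsBelow gs.length ∧
      u.eval (gateValues gs) = MvPolynomial.aeval φ (smlProj blk S p) ∧
      operandVarSet (gateVarSets gs) u ⊆ S.biUnion V)
    (hleaf : ∀ v : σ, ∃ u : Operand R τ, u.RefsBelow gs.length ∧
      u.eval (gateValues gs) = φ v ∧ operandVarSet (gateVarSets gs) u ⊆ V (blk v))
    (o : Operand R σ) (S : Finset ι) :
    ∃ u : Operand R τ, u.RefsBelow gs.length ∧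
      u.eval (gateValues gs) = MvPolynomial.aeval φ (smlProj blk S (o.eval vals)) ∧
      operandVarSet (gateVarSets gs) u ⊆ S.biUnion V := by
  cases o with
  | var v =>
    simp only [Operand.eval, smlProj_X]
    by_cases hS : S = {blk v}
    · subst hS
      rw [if_pos rfl, MvPolynomial.aeval_X]
      exact avail_budget_mono (by rw [Finset.singleton_biUnion]) (hleaf v)
    · rw [if_neg hS, map_zero]
      exact avail_congr (by simp) (avail_C gs (0 : R) _)
  | const c =>
    simp only [Operand.eval, smlProj_C]
    by_cases hS : S = ∅
    · rw [if_pos hS, MvPolynomial.aeval_C, MvPolynomial.algebraMap_eq]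
      exact avail_C gs c _
    · rw [if_neg hS, map_zero]
      exact avail_congr (by simp) (avail_C gs (0 : R) _)
  | gate j =>
    simp only [Operand.eval, List.getD_eq_getElem?_getD]
    by_cases hj : j < vals.length
    · rw [List.getElem?_eq_getElem hj, Option.getD_some]
      exact hvals _ (List.getElem_mem hj) S
    · rw [List.getElem?_eq_none_iff.mpr (Nat.le_of_not_lt hj), Option.getD_none, map_zero, map_zero]
      exact avail_congr (by simp) (avail_C gs (0 : R) _)

/-- **One gate.** From the projections of the values of all operands, at most `2 · 4 ^ |ι|`
appended gates make all projections of the value of one fan-in-two gate available: sums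
componentwise, products by the product rule `α_S = ∑_{S₁ ⊆ S} β_{S₁} γ_{S∖S₁}` whose factors live
in the disjoint budgets `⋃_{S₁} V`, `⋃_{S∖S₁} V`. [cite: LimayeSrinivasanTavenas2025, Lemma 12] -/
theorem extend_gate (hV : ∀ i j : ι, i ≠ j → Disjoint (V i) (V j))
    {gs : List (Gate R τ)} (h2 : ∀ g ∈ gs, g.fanIn ≤ 2)
    (hsm : IsSyntacticallyMultilinear (⟨gs, Operand.gate 0⟩ : ArithCircuit R τ))
    (vals : List (MvPolynomial σ R))
    (hops : ∀ (o : Operand R σ) (S : Finset ι), ∃ u : Operand R τ, u.RefsBelow gs.length ∧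
      u.eval (gateValues gs) = MvPolynomial.aeval φ (smlProj blk S (o.eval vals)) ∧
      operandVarSet (gateVarSets gs) u ⊆ S.biUnion V)
    (g : Gate R σ) (hg : g.fanIn ≤ 2) :
    ∃ gs' : List (Gate R τ), gs <+: gs' ∧ (∀ g ∈ gs', g.fanIn ≤ 2) ∧
      IsSyntacticallyMultilinear (⟨gs', Operand.gate 0⟩ : ArithCircuit R τ) ∧
      gs'.length ≤ gs.length + 2 * 4 ^ Fintype.card ι ∧
      ∀ S : Finset ι, ∃ u : Operand R τ, u.RefsBelow gs'.length ∧
        u.eval (gateValues gs') = MvPolynomial.aeval φ (smlProj blk S (g.eval vals)) ∧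
        operandVarSet (gateVarSets gs') u ⊆ S.biUnion V := by
  classical
  -- it suffices to reach each block set `S` at cost `2 · 2 ^ |ι|` from any good extension
  have hcard : (2 * 2 ^ Fintype.card ι) * (Finset.univ : Finset (Finset ι)).card =
      2 * 4 ^ Fintype.card ι := by
    rw [Finset.card_univ, Fintype.card_finset, show (4 : ℕ) = 2 * 2 by norm_num, mul_pow]; ring
  suffices hstep : ∀ S ∈ (Finset.univ : Finset (Finset ι)), ∀ gs' : List (Gate R τ), gs <+: gs' →
      (∀ g ∈ gs', g.fanIn ≤ 2) →
      IsSyntacticallyMultilinear (⟨gs', Operand.gate 0⟩ : ArithCircuit R τ) →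
      ∃ gs'' : List (Gate R τ), gs' <+: gs'' ∧ (∀ g ∈ gs'', g.fanIn ≤ 2) ∧
        IsSyntacticallyMultilinear (⟨gs'', Operand.gate 0⟩ : ArithCircuit R τ) ∧
        gs''.length ≤ gs'.length + 2 * 2 ^ Fintype.card ι ∧
        ∃ u : Operand R τ, u.RefsBelow gs''.length ∧
          u.eval (gateValues gs'') = MvPolynomial.aeval φ (smlProj blk S (g.eval vals)) ∧
          operandVarSet (gateVarSets gs'') u ⊆ S.biUnion V by
    obtain ⟨gs', hpre, h2', hsm', hlen, havail⟩ :=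
      iterate_targets (Finset.univ : Finset (Finset ι))
        (fun S => MvPolynomial.aeval φ (smlProj blk S (g.eval vals))) (fun S => S.biUnion V)
        (2 * 2 ^ Fintype.card ι) h2 hsm hstep
    exact ⟨gs', hpre, h2', hsm', by rw [hcard] at hlen; exact hlen, fun S => havail S (Finset.mem_univ S)⟩
  intro S _ gs' hpre h2' hsm'
  have hops' : ∀ (o : Operand R σ) (S : Finset ι), ∃ u : Operand R τ, u.RefsBelow gs'.length ∧
      u.eval (gateValues gs') = MvPolynomial.aeval φ (smlProj blk S (o.eval vals)) ∧
      operandVarSet (gateVarSets gs') u ⊆ S.biUnion V := fun o S => avail_mono hpre (hops o S)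
  have hpos : 1 ≤ 2 * 2 ^ Fintype.card ι := by
    have := Nat.one_le_two_pow (n := Fintype.card ι); omega
  cases g with
  | sum args =>
    match args, hg with
    | [], _ =>
      refine ⟨gs', List.prefix_rfl, h2', hsm', by omega, ?_⟩
      refine avail_congr ?_ (avail_C gs' (0 : R) _)
      simp [Gate.eval]
    | [(a, o)], _ =>
      obtain ⟨gs'', hpre'', h2'', hsm'', hlen'', hav⟩ :=
        extend_lin h2' hsm' a (0 : R) (hops' o S) (hops' o S)
      refine ⟨gs'', hpre'', h2'', hsm'', by omega, avail_congr ?_ hav⟩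
      simp [Gate.eval, map_smul]
    | [(a, o), (b, o')], _ =>
      obtain ⟨gs'', hpre'', h2'', hsm'', hlen'', hav⟩ :=
        extend_lin h2' hsm' a b (hops' o S) (hops' o' S)
      refine ⟨gs'', hpre'', h2'', hsm'', by omega, avail_congr ?_ hav⟩
      simp [Gate.eval, map_smul]
    | _ :: _ :: _ :: _, hg => simp [Gate.fanIn, Gate.args] at hg
  | prod args =>
    match args, hg with
    | [], _ =>
      refine ⟨gs', List.prefix_rfl, h2', hsm', by omega, ?_⟩
      simp only [Gate.eval, List.map_nil, List.prod_nil]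
      rw [← MvPolynomial.C_1, smlProj_C]
      by_cases hS : S = ∅
      · rw [if_pos hS, MvPolynomial.aeval_C, MvPolynomial.algebraMap_eq]
        exact avail_C gs' (1 : R) _
      · rw [if_neg hS, map_zero]
        exact avail_congr (by simp) (avail_C gs' (0 : R) _)
    | [o], _ =>
      refine ⟨gs', List.prefix_rfl, h2', hsm', by omega, avail_congr ?_ (hops' o S)⟩
      simp [Gate.eval]
    | [o, o'], _ =>
      have hsub : S.card ≤ Fintype.card ι := by
        simpa using Finset.card_le_univ S
      obtain ⟨gs'', hpre'', h2'', hsm'', hlen'', hav⟩ :=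
        extend_prodSum S.powerset h2' hsm'
          (fun S₁ => MvPolynomial.aeval φ (smlProj blk S₁ (o.eval vals)))
          (fun S₁ => MvPolynomial.aeval φ (smlProj blk (S \ S₁) (o'.eval vals)))
          (fun S₁ => S₁.biUnion V) (fun S₁ => (S \ S₁).biUnion V) (S.biUnion V)
          (fun S₁ _ => by
            rw [Finset.disjoint_biUnion_left]
            intro i hi
            rw [Finset.disjoint_biUnion_right]
            intro j hj
            exact hV i j (by rintro rfl; exact (Finset.mem_sdiff.mp hj).2 hi))
          (fun S₁ hS₁ => Finset.biUnion_subset_biUnion_of_subset_left V (Finset.mem_powerset.mp hS₁))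
          (fun S₁ _ => Finset.biUnion_subset_biUnion_of_subset_left V Finset.sdiff_subset)
          (fun S₁ _ => hops' o S₁) (fun S₁ _ => hops' o' (S \ S₁))
      refine ⟨gs'', hpre'', h2'', hsm'', ?_, avail_congr ?_ hav⟩
      · rw [Finset.card_powerset] at hlen''
        have : 2 * 2 ^ S.card ≤ 2 * 2 ^ Fintype.card ι :=
          Nat.mul_le_mul_left 2 (Nat.pow_le_pow_right (by norm_num) hsub)
        omega
      · simp only [Gate.eval, List.map_cons, List.map_nil, List.prod_cons, List.prod_nil, mul_one]
        rw [smlProj_mul, map_sum]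
        refine Finset.sum_congr rfl fun S₁ _ => ?_
        rw [map_mul]
    | _ :: _ :: _ :: _, hg => simp [Gate.fanIn, Gate.args] at hg

end Gate

/-! ### All gates -/

section Main

variable [Fintype ι] (blk : σ → ι) (φ : σ → MvPolynomial τ R) (V : ι → Finset τ)

/-- **All projections of all gate values** of a fan-in-two gate list `cs` over `σ`, at
`2 · 4 ^ |ι|` appended gates per gate of `cs` (induction along the left fold `gateValues`).
[cite: LimayeSrinivasanTavenas2025, Lemma 12] -/
theorem extend_gates (hV : ∀ i j : ι, i ≠ j → Disjoint (V i) (V j))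
    {gs₀ : List (Gate R τ)} (h2₀ : ∀ g ∈ gs₀, g.fanIn ≤ 2)
    (hsm₀ : IsSyntacticallyMultilinear (⟨gs₀, Operand.gate 0⟩ : ArithCircuit R τ))
    (hleaf : ∀ v : σ, ∃ u : Operand R τ, u.RefsBelow gs₀.length ∧
      u.eval (gateValues gs₀) = φ v ∧ operandVarSet (gateVarSets gs₀) u ⊆ V (blk v))
    (cs : List (Gate R σ)) (hcs : ∀ g ∈ cs, g.fanIn ≤ 2) :
    ∃ gs : List (Gate R τ), gs₀ <+: gs ∧ (∀ g ∈ gs, g.fanIn ≤ 2) ∧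
      IsSyntacticallyMultilinear (⟨gs, Operand.gate 0⟩ : ArithCircuit R τ) ∧
      gs.length ≤ gs₀.length + 2 * 4 ^ Fintype.card ι * cs.length ∧
      ∀ p ∈ gateValues cs, ∀ S : Finset ι, ∃ u : Operand R τ, u.RefsBelow gs.length ∧
        u.eval (gateValues gs) = MvPolynomial.aeval φ (smlProj blk S p) ∧
        operandVarSet (gateVarSets gs) u ⊆ S.biUnion V := by
  induction cs using List.reverseRecOn with
  | nil =>
    refine ⟨gs₀, List.prefix_rfl, h2₀, hsm₀, by simp, fun p hp => ?_⟩
    simp [gateValues] at hp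
  | append_singleton cs g ih =>
    obtain ⟨gs₁, hpre₁, h2₁, hsm₁, hlen₁, havail₁⟩ :=
      ih fun g' hg' => hcs g' (List.mem_append_left _ hg')
    have hleaf₁ : ∀ v : σ, ∃ u : Operand R τ, u.RefsBelow gs₁.length ∧
        u.eval (gateValues gs₁) = φ v ∧ operandVarSet (gateVarSets gs₁) u ⊆ V (blk v) :=
      fun v => avail_mono hpre₁ (hleaf v)
    have hops := avail_operand blk φ V (gateValues cs) havail₁ hleaf₁
    obtain ⟨gs₂, hpre₂, h2₂, hsm₂, hlen₂, havail₂⟩ :=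
      extend_gate blk φ V hV h2₁ hsm₁ (gateValues cs) hops g
        (hcs g (List.mem_append_right _ (List.mem_singleton_self g)))
    refine ⟨gs₂, hpre₁.trans hpre₂, h2₂, hsm₂, ?_, fun p hp S => ?_⟩
    · simp only [List.length_append, List.length_singleton]
      rw [Nat.mul_succ]; omega
    · rw [gateValues_append_singleton, List.mem_append, List.mem_singleton] at hp
      rcases hp with hp | rfl
      · exact avail_mono hpre₂ (havail₁ p hp S)
      · exact havail₂ S

/-- **Set-multilinear projections of a circuit by a syntactically multilinear gate list**
(Limaye–Srinivasan–Tavenas 2025, proof of Lemma 12, in the straight-line model; syntactic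
multilinearity à la Raz–Yehudayoff 2008 §2). Block map `blk : σ → ι`, leaf substitution `φ`,
pairwise disjoint variable budgets `V`; a fan-in-two syntactically multilinear gate list `gs₀`
making every leaf `φ v` available with syntactic variable set inside `V (blk v)`. Then for every
fan-in-two circuit `Γ` over `σ`, at most `2 · 4 ^ |ι| · |Γ|` appended gates (fan-in two, still
syntactically multilinear) make `aeval φ (smlProj blk S Γ.eval)` available for every block set `S`,
through an operand whose syntactic variable set lies in `⋃_{i ∈ S} V i`.
[cite: LimayeSrinivasanTavenas2025, Lemma 12] -/
theorem exists_smlProj_gateList (hV : ∀ i j : ι, i ≠ j → Disjoint (V i) (V j))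
    {gs₀ : List (Gate R τ)} (h2₀ : ∀ g ∈ gs₀, g.fanIn ≤ 2)
    (hsm₀ : IsSyntacticallyMultilinear (⟨gs₀, Operand.gate 0⟩ : ArithCircuit R τ))
    (hleaf : ∀ v : σ, ∃ u : Operand R τ, u.RefsBelow gs₀.length ∧
      u.eval (gateValues gs₀) = φ v ∧ operandVarSet (gateVarSets gs₀) u ⊆ V (blk v))
    (Γ : ArithCircuit R σ) (hΓ : Γ.IsFanInTwo) :
    ∃ gs : List (Gate R τ), gs₀ <+: gs ∧ (∀ g ∈ gs, g.fanIn ≤ 2) ∧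
      IsSyntacticallyMultilinear (⟨gs, Operand.gate 0⟩ : ArithCircuit R τ) ∧
      gs.length ≤ gs₀.length + 2 * 4 ^ Fintype.card ι * Γ.size ∧
      ∀ S : Finset ι, ∃ u : Operand R τ, u.RefsBelow gs.length ∧
        u.eval (gateValues gs) = MvPolynomial.aeval φ (smlProj blk S Γ.eval) ∧
        operandVarSet (gateVarSets gs) u ⊆ S.biUnion V := by
  obtain ⟨gs, hpre, h2, hsm, hlen, havail⟩ := extend_gates blk φ V hV h2₀ hsm₀ hleaf Γ.gates hΓ
  have hleaf' : ∀ v : σ, ∃ u : Operand R τ, u.RefsBelow gs.length ∧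
      u.eval (gateValues gs) = φ v ∧ operandVarSet (gateVarSets gs) u ⊆ V (blk v) :=
    fun v => avail_mono hpre (hleaf v)
  exact ⟨gs, hpre, h2, hsm, hlen,
    fun S => avail_operand blk φ V (gateValues Γ.gates) havail hleaf' Γ.output S⟩

end Main

/-! ### Corollary: set-multilinear polynomials have syntactically multilinear circuits -/

section Corollary

variable [Fintype ι] [Fintype σ] [DecidableEq σ]

/-- **Set-multilinear ⇒ syntactically multilinear at cost `2 · 4^{#blocks}`** (the straight-line
form of Limaye–Srinivasan–Tavenas 2025, Lemma 12: a circuit for a set-multilinear polynomial can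
be made set-multilinear, blowing up by `2^{O(d)}` for `d` blocks; a set-multilinear circuit in
this sense multiplies disjoint blocks, hence disjoint variable sets — Raz–Yehudayoff 2008 §2): if
`f` is set-multilinear over the block set `S` for `blk : σ → ι`, then
`smCircuitSize f ≤ 2 · 4 ^ |ι| · L(f)`. [cite: LimayeSrinivasanTavenas2025, Lemma 12] -/
theorem smCircuitSize_le_of_isSetMultilinear (blk : σ → ι) {S : Finset ι} {f : MvPolynomial σ R}
    (hf : IsSetMultilinear blk S f) :
    smCircuitSize f ≤ (2 * 4 ^ Fintype.card ι * complexity f : ℕ) := by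
  classical
  obtain ⟨Γ, hΓ2, hΓf, hΓs⟩ := ArithCircuit.exists_computes_size_eq_complexity f
  -- leaves: the variables themselves, budget = their own block
  obtain ⟨gs, -, h2, hsm, hlen, havail⟩ :=
    exists_smlProj_gateList blk (fun v : σ => (X v : MvPolynomial σ R))
      (fun i : ι => Finset.univ.filter fun v : σ => blk v = i)
      (fun i j hij => by
        rw [Finset.disjoint_filter]
        intro v _ hvi hvj
        exact hij (hvi.symm.trans hvj))
      (gs₀ := []) (by simp) (isSyntacticallyMultilinear_of_gates_eq_nil rfl)
      (fun v => ⟨.var v, trivial, rfl, by simp⟩) Γ hΓ2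
  obtain ⟨u, -, hval, -⟩ := havail S
  have hP : (⟨gs, u⟩ : ArithCircuit R σ).Computes f := by
    show u.eval (gateValues gs) = f
    rw [hval, show Γ.eval = f from hΓf, hf.smlProj_eq, MvPolynomial.aeval_X_left, AlgHom.coe_id,
      id_eq]
  refine (smCircuitSize_le (P := ⟨gs, u⟩) h2
    ((SmAppend.isSyntacticallyMultilinear_iff_gates gs (Operand.gate 0) u).mp hsm) hP).trans ?_
  have : (⟨gs, u⟩ : ArithCircuit R σ).size = gs.length := rfl
  rw [this, ← hΓs]
  exact_mod_cast (by simpa using hlen)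

end Corollary

end SmlHomogenise

end Literature.Computability.AlgebraicComplexity

end
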